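import Literature.MathematicalPhysics.QuantumFieldTheory.Balaban1983to89.B4Cor23ZeroTorusSolve

/-!
# `Balaban1983to89.B4Cor23ZeroTorus` — T. Bałaban, *Regularity and decay of lattice Green's functions*, Commun. Math. Phys. **89** (1983)
# 571–597 [Balaban1983RegularityDecay], COROLLARY 2.3 (2.30) AT `A = 0` ON THE TORUS, ALL FOUR PAIRINGS, file 2 of 2:
# `|⟨f, G_kf′⟩|, |⟨f, ∂^η_μG_kf′⟩|, |⟨f, G_k∂^{η*}_νf′⟩|, |⟨f, ∂^η_μG_k∂^{η*}_νf′⟩| ≤ c₀e^{−δ₀dist(supp f, supp f′)}‖f‖₂‖f′‖₂` for Bałaban's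
# concrete scalar torus tower, EVERY volume, EVERY level `1 ≤ k ≤ m + K`, every `m² ≥ 0`, with explicit `c₀(L,a)`, `δ₀(d,L,a)`

statement-level skeleton of published theorems with citation tags; proofs where landed; nothing here is a claim about the Yang–Mills mass gap

PDF held: `paper:balaban1983-cmp89-regularity-decay` (journal page = PDF page + 570), p. 580 [PDF 10] (2.30), p. 581 [PDF 11], p. 572 [PDF 2] (the
torus), p. 573 [PDF 3] (1.8); materialised `p0010.txt`, `p0011.txt`, `p0002.txt`–`p0004.txt`, read by this seat.

CITATION HEADER (lean-in-tree rule).  Cell `lit-balaban` (HOME `run/shared/lean/pub/lit-balaban/`), Phase-2 proof seat **p14** gen 10 (unit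
`lit-balaban-p14`); SKELETON row **B4.Cor2.3** (owner r01), a TORUS INSTANCE of (2.30) at `A = 0` (`Ω = Ω₀ = T_η`: the δG-clause of p. 581 is
void there).  SIBLINGS, BY NAME: b04's `B4Cor23Zero.cor23_main_zeroField` (the same four pairings for NEUMANN REGIONS of `ℤ^{d+1}`, every mesh) and
`B4Cor23ZeroEta` (the `B4.Cor23Printed` family of regions); p14 gen 9's `B1Cor23ZeroFieldTorus.propagatorK_pairing_bound` (first pairing only, via
Schur over p38's sup-norm decay, on the (Higgs)₂,₃ sub-family).  USED BY NAME, never restated: file 1 `B4Cor23ZeroTorusSolve.{solve_bound,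
solveT_bound, gammaPrime_pos}`, `B5CombesThomasTorus.{LipX, LipX.neg, wt, wt_inv, wt_pos, pmul, pmul_inv_pmul, abs_deriv_pmul_le, nsq, dirE,
sum_sq_deriv_le_dirE}`, `B5Ineq137Torus.{distX, distX_nonneg, distX_self, T_triangle}`, `B4Ineq115Torus.Marg`, `B5Display136Torus.Grs`,
`B1RG242Torus.deriv`.

WHAT IS PRINTED (verbatim).  p. 580 [PDF 10]: *"Remark. Let us notice that this lemma alone implies a weaker version of Proposition I.2.1 with
L²-norms. More exactly we have  Corollary 2.3. If Ω and A are as in Proposition I.2.1, then there exist positive constants c₀, δ₀ such that for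
arbitrary scalar field configurations f, f′ defined on Ω, we have |⟨f, G_k(Ω,A)f′⟩|, |⟨f, D^η_{A,μ}G_k(Ω,A)f′⟩|, |⟨f, G_k(Ω,A)D^{η*}_{A,ν}f′⟩|,
|⟨f, D^η_{A,μ}G_k(Ω,A)D^{η*}_{A,ν}f′⟩| ≤ c₀e^{−δ₀dist(supp f, supp f′)}‖f‖₂‖f′‖₂. (2.30)"*; p. 581 [PDF 11]: *"The same inequalities hold for
δG_k(Ω,Ω₀,A) with the additional factor e^{−δ₀(dist(supp f, Ωᶜ) + dist(supp f′, Ωᶜ))}.  Of course it is enough to prove it for f, f′ with supports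
in unit cubes, and the proof proceeds as before using only the L²-bounds of Lemma 2.1. Let us notice also that now there are no restrictions on
supports of f, f′, so in this aspect the Corollary is a little bit stronger than Proposition I.2.1."*; p. 572 [PDF 2]: *"Another common case is
to consider operators on subsets of a torus T_η which we identify with a rectangular parallelepiped in ηZ^d with periodic conditions."*

DICTIONARY.  `T_η = Site P 0` (the fine torus of the `Setup`/`Params` family, `2L^{m+K}` sites per direction), `η = L^{−k}` at level
`1 ≤ k ≤ m + K`; `G_k(T_η, 0) = G_k^{resc} = Grs P a m² k = (−Δ^η + (L^kε)²m² + a_kQ^*_kQ_k)⁻¹` ([B1] (2.22), [B4] (1.6) with `U = 1`, the mass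
`m²(L^kε)²` of the rescaled operator); `D^η_{0,μ} = ∂^η_μ = deriv P 0 η μ` (forward difference (1.4)), `D^{η*}_{0,ν} = (∂^η_ν)ᵀ` (the adjoint for
the scalar product (1.5): sites and bonds carry the same weight `η^d`, `B1RG242Torus` NOT-CERTIFIED (vii)); `⟨f, g⟩ = η^d·f ⬝ᵥ g` and `‖f‖₂ =
η^{d/2}√(nsq f)` — the common factor `η^d` CANCELS between the two sides of (2.30), which is therefore stated for the unweighted `⬝ᵥ` / `nsq`;
`dist(supp f, supp f′) ↦` any `r` with `r ≤ distX P k x x′ = η·|x − x′|_∞` (sup torus metric) for all `x ∈ supp f`, `x′ ∈ supp f′` (the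
print's Euclidean distance dominates the sup distance, so the printed exponent follows with `δ₀/√d`).

WHAT THIS FILE PROVES (kernel-checked, zero `sorry`, theorems only; axioms standard).
* §1 `exists_exponent`: the distance-to-a-set exponent `ρ = dist_η(·, T)` is 1-Lipschitz (`LipX`), vanishes on `T`, is `≥ 0`, and is `≥ r`
  wherever all points of `T` are `≥ r` away; §2 `dot_eq_sum_support`, `abs_dot_le_of_support` (Cauchy–Schwarz on `supp f`), `nsq_pmul_eq_of_one`;
  §3 the two EXTRACTION LEMMAS `sum_sq_le_of_exponent` (`Σ_{S}v² ≤ e^{−2δr}‖e^{δρ}v‖²` when `ρ ≥ r` on `S`) and `sum_sq_deriv_le_of_exponent`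
  (`Σ_{S}(∂^η_μv)² ≤ 9e^{−2δr}(Σ_ν‖∂_ν(e^{δρ}v)‖² + ‖e^{δρ}v‖²)`, weighted Leibniz rule).
* §4 **(2.30) AT `A = 0` ON THE TORUS, EXPLICIT FORM** — `pairing_G`, `pairing_DG`, `pairing_GDt`, `pairing_DGDt`: at one volume, for
  `1 ≤ k ≤ m + K`, `a > 0`, `m² ≥ 0`, any admissible `δ` (`0 ≤ δ`, `4δ ≤ 1`, `(2d + 4a)δ² ≤ γ′/4`, `γ′ = min{1, a(1 − L⁻²)}`), all `f, f′, μ, ν`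
  and every `r` below the `η`-distance of the supports: the four pairings are `≤ (c/γ′)·e^{−δr}·√(nsq f)·√(nsq f′)` with `c = 4, 12, 8, 24`.
* §5 **`cor23_zero_torus`** — THE PRINTED QUANTIFIER SHAPE: for `L > 1`, `a > 0` and every `d` there are `δ₀, c₀ > 0` (functions of `d, L, a`:
  `δ₀ = min{¼, γ′/(8d + 16a + 4)}`, `c₀ = 24/γ′`) such that for EVERY volume `(m, K)` of the family with `P.d = d`, `P.L = L`, every `m² ≥ 0`,
  every level `1 ≤ k ≤ m + K`, all `μ, ν, f, f′` and every such `r`, ALL FOUR inequalities (2.30) hold with `c₀e^{−δ₀r}`.  NO mass cap, no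
  smallness of `e` (there is no field), no restriction on the supports (as the print remarks).
HONEST SCOPE / DIVERGENCE.  (i) `A = 0`, `U ≡ 1`, one real component (`f : Ω → R^N` componentwise), the WHOLE torus only (no `Ω ⊊ T_η` with
Neumann conditions — b04's `B4Cor23Zero` has those on `ℤ^{d+1}` —, hence no δG-clause); (ii) METHOD: one-step Combes–Thomas conjugation (file 1),
NOT the print's random-walk expansion with the `L²` bounds of Lemma 2.1 — a disclosed divergence serving the printed STATEMENT; (iii) constants
explicit, crude, not the print's; sup torus metric in `η`-units; (iv) nothing here is summit progress.  Successor (same seat): the (Higgs)₂,₃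
MODEL INSTANCE of the three derivative pairings (sequel of `B1Cor23ZeroFieldTorus`) through gen 8/9's dictionaries `cmpAt`/`sderiv_propagatorK_apply_at`.
-/

namespace Literature.MathematicalPhysics.QuantumFieldTheory.Balaban1983to89

open Matrix Finset

noncomputable section

namespace B4Cor23ZeroTorus

open B1RG242Torus B5Ineq137Torus B5CombesThomasTorus B4Ineq115Torus B5Display136Torus B4Cor23ZeroTorusSolve

variable {P : Params} {k : ℕ}

/-! ## §1 The exponent: distance to the support of the source -/

/-- triangle inequality for `distX`. [folklore] -/
private theorem distX_triangle (k : ℕ) (x y z : Site P 0) : distX P k x z ≤ distX P k x y + distX P k y z := by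
  unfold distX
  rw [← mul_add]
  exact mul_le_mul_of_nonneg_left (T_triangle P 0 x y z) (inv_nonneg.mpr (pow_pos P.cast_L_pos _).le)

/-- **The Combes–Thomas exponent**: for a nonempty finite set `T ⊂ T_η` the function `ρ = dist_η(·, T)` (sup torus metric, `η`-units) is
1-Lipschitz (`LipX`), vanishes on `T`, is non-negative, and `ρ(x) ≥ r` whenever every point of `T` is `≥ r` away from `x` — the weight
`e^{δρ}` of the conjugation equals `1` on the source and is `≥ e^{δ·dist(supp f, supp f′)}` on the test function. [cite:
Balaban1983RegularityDecay, Cor. 2.3 (2.30) p.580 (the exponent `δ₀dist(supp f, supp f′)`)] -/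
theorem exists_exponent (k : ℕ) {T : Finset (Site P 0)} (hT : T.Nonempty) :
    ∃ ρ : Site P 0 → ℝ, LipX P k ρ ∧ (∀ x ∈ T, ρ x = 0) ∧ (∀ x, 0 ≤ ρ x) ∧
      ∀ (x : Site P 0) (r : ℝ), (∀ x' ∈ T, r ≤ distX P k x x') → r ≤ ρ x := by
  refine ⟨fun x => T.inf' hT (fun x' => distX P k x x'), ?_, ?_, ?_, ?_⟩
  · intro x z
    have key : ∀ x z : Site P 0,
        T.inf' hT (fun x' => distX P k x x') - T.inf' hT (fun x' => distX P k z x') ≤ distX P k x z := by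
      intro x z
      obtain ⟨x', hx'T, hx'⟩ := Finset.exists_mem_eq_inf' hT (fun x' => distX P k z x')
      have h1 : T.inf' hT (fun x'' => distX P k x x'') ≤ distX P k x x' := Finset.inf'_le _ hx'T
      have h2 := distX_triangle k x z x'
      rw [hx']
      linarith
    rw [abs_sub_le_iff]
    refine ⟨key x z, ?_⟩
    rw [B5GpSettingTorus.distX_comm]
    exact key z x
  · intro x hx
    apply le_antisymm
    · have h := Finset.inf'_le (fun x' => distX P k x x') hx
      rwa [distX_self] at h
    · exact Finset.le_inf' _ _ fun x' _ => distX_nonneg P k x x'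
  · intro x
    exact Finset.le_inf' _ _ fun x' _ => distX_nonneg P k x x'
  · intro x r hr
    exact Finset.le_inf' _ _ fun x' hx' => hr x' hx'

/-! ## §2 Support bookkeeping and Cauchy–Schwarz on the support -/

/-- `f ⬝ᵥ h` only sees the support of `f`. [folklore] -/
private theorem dot_eq_sum_support (f h : Site P 0 → ℝ) :
    f ⬝ᵥ h = ∑ x ∈ Finset.univ.filter (fun x => f x ≠ 0), f x * h x := by
  rw [Finset.sum_filter]
  refine Finset.sum_congr rfl fun x _ => ?_
  by_cases hx : f x = 0
  · rw [if_neg (not_not.mpr hx), hx, zero_mul]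
  · rw [if_pos hx]

/-- **Cauchy–Schwarz on the support of the test function**: if `Σ_{supp f} h² ≤ B²` (`B ≥ 0`) then `|f ⬝ᵥ h| ≤ √(Σf²)·B`.
[cite: Balaban1983RegularityDecay, Cor. 2.3 (2.30) p.580 (the `L²` norms `‖f‖₂‖f′‖₂`)] -/
theorem abs_dot_le_of_support (f h : Site P 0 → ℝ) {B : ℝ} (hB : 0 ≤ B)
    (hh : ∑ x ∈ Finset.univ.filter (fun x => f x ≠ 0), h x ^ 2 ≤ B ^ 2) :
    |f ⬝ᵥ h| ≤ Real.sqrt (nsq P f) * B := by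
  set S := Finset.univ.filter (fun x => f x ≠ 0) with hS
  have hcs := Finset.sum_mul_sq_le_sq_mul_sq S f h
  have hfS : ∑ x ∈ S, f x ^ 2 ≤ nsq P f := by
    unfold nsq
    exact Finset.sum_le_univ_sum_of_nonneg fun x => sq_nonneg (f x)
  have hn := nsq_nonneg (P := P) f
  rw [dot_eq_sum_support]
  calc |∑ x ∈ S, f x * h x| = Real.sqrt ((∑ x ∈ S, f x * h x) ^ 2) := (Real.sqrt_sq_eq_abs _).symm
    _ ≤ Real.sqrt (nsq P f * B ^ 2) := by
        refine Real.sqrt_le_sqrt (hcs.trans ?_)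
        exact mul_le_mul hfS hh (Finset.sum_nonneg fun x _ => sq_nonneg _) hn
    _ = Real.sqrt (nsq P f) * B := by rw [Real.sqrt_mul hn, Real.sqrt_sq hB]

/-- a weight equal to `1` on the support does not change `Σg²`. [folklore] -/
private theorem nsq_pmul_eq_of_one {w g : Site P 0 → ℝ} (hw : ∀ x, g x ≠ 0 → w x = 1) : nsq P (pmul w g) = nsq P g := by
  unfold nsq
  refine Finset.sum_congr rfl fun x _ => ?_
  rw [pmul_apply]
  by_cases hx : g x = 0
  · rw [hx, mul_zero]
  · rw [hw x hx, one_mul]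

/-! ## §3 Extraction: values and differences of `v = e^{−δρ}u` where `ρ ≥ r` -/

section Extract

variable {ρ : Site P 0 → ℝ} {δ r : ℝ} {S : Finset (Site P 0)}

/-- **Extraction of values**: if `ρ ≥ r` on `S` then `Σ_{x∈S} v(x)² ≤ e^{−2δr}·Σ_x (e^{δρ}v)(x)²`. [cite: Balaban1983RegularityDecay, Cor. 2.3
(2.30) p.580 (the factor `e^{−δ₀dist(supp f, supp f′)}`)] -/
theorem sum_sq_le_of_exponent (hδ0 : 0 ≤ δ) (hS : ∀ x ∈ S, r ≤ ρ x) (v : Site P 0 → ℝ) :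
    ∑ x ∈ S, v x ^ 2 ≤ Real.exp (-(2 * δ * r)) * nsq P (pmul (wt P δ ρ) v) := by
  have hpt : ∀ x ∈ S, v x ^ 2 ≤ Real.exp (-(2 * δ * r)) * (pmul (wt P δ ρ) v x) ^ 2 := by
    intro x hx
    have hw := wt_pos (P := P) δ ρ x
    have hv : v x = (wt P δ ρ x)⁻¹ * pmul (wt P δ ρ) v x := by
      rw [pmul_apply, ← mul_assoc, inv_mul_cancel₀ hw.ne', one_mul]
    have hinv : (wt P δ ρ x)⁻¹ ≤ Real.exp (-(δ * r)) := by
      rw [wt, ← Real.exp_neg, Real.exp_le_exp]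
      have := mul_le_mul_of_nonneg_left (hS x hx) hδ0
      linarith
    have hinv0 : 0 ≤ (wt P δ ρ x)⁻¹ := inv_nonneg.mpr hw.le
    have hsq : ((wt P δ ρ x)⁻¹) ^ 2 ≤ Real.exp (-(2 * δ * r)) := by
      calc ((wt P δ ρ x)⁻¹) ^ 2 ≤ (Real.exp (-(δ * r))) ^ 2 := pow_le_pow_left₀ hinv0 hinv 2
        _ = Real.exp (-(2 * δ * r)) := by rw [sq, ← Real.exp_add]; ring_nf
    rw [hv, mul_pow]
    exact mul_le_mul_of_nonneg_right hsq (sq_nonneg _)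
  calc ∑ x ∈ S, v x ^ 2 ≤ ∑ x ∈ S, Real.exp (-(2 * δ * r)) * (pmul (wt P δ ρ) v x) ^ 2 := Finset.sum_le_sum hpt
    _ = Real.exp (-(2 * δ * r)) * ∑ x ∈ S, (pmul (wt P δ ρ) v x) ^ 2 := by rw [Finset.mul_sum]
    _ ≤ Real.exp (-(2 * δ * r)) * nsq P (pmul (wt P δ ρ) v) := by
        refine mul_le_mul_of_nonneg_left ?_ (Real.exp_nonneg _)
        unfold nsq
        exact Finset.sum_le_univ_sum_of_nonneg fun x => sq_nonneg _

/-- **Extraction of differences**: if `ρ` is Lipschitz, `0 ≤ δ`, `4δ ≤ 1` and `ρ ≥ r` on `S`, then for `u = e^{δρ}v`: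
`Σ_{x∈S} (∂^η_μv)(x)² ≤ 9e^{−2δr}·(Σ_νΣ_x(∂^η_νu)² + Σ_x u²)` (weighted Leibniz rule `|∂(e^{−δρ}u)| ≤ e^{−δρ}(³⁄₂|∂u| + 2δ|u|)`).
[cite: Balaban1983RegularityDecay, Cor. 2.3 (2.30) p.580 (the pairings with `D^η_{A,μ}`), (2.29) p.580] -/
theorem sum_sq_deriv_le_of_exponent (hρ : LipX P k ρ) (hδ0 : 0 ≤ δ) (hδ4 : 4 * δ ≤ 1) (hS : ∀ x ∈ S, r ≤ ρ x)
    (μ : Fin P.d) (v : Site P 0 → ℝ) :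
    ∑ x ∈ S, ((deriv P 0 ((P.L : ℝ) ^ k)⁻¹ μ *ᵥ v) x) ^ 2
      ≤ 9 * Real.exp (-(2 * δ * r)) *
        (dirE P k (pmul (wt P δ ρ) v) + nsq P (pmul (wt P δ ρ) v)) := by
  set u := pmul (wt P δ ρ) v with hu
  set D := deriv P 0 ((P.L : ℝ) ^ k)⁻¹ μ with hD
  -- `v = e^{−δρ}u = e^{δ(−ρ)}u`
  have hv : v = pmul (wt P δ (fun z => -ρ z)) u := by
    funext x
    rw [pmul_apply, ← wt_inv, hu, pmul_apply, ← mul_assoc, inv_mul_cancel₀ (wt_ne_zero δ ρ x), one_mul]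
  have hpt : ∀ x ∈ S, ((D *ᵥ v) x) ^ 2 ≤ 9 / 2 * Real.exp (-(2 * δ * r)) * (((D *ᵥ u) x) ^ 2 + (u x) ^ 2) := by
    intro x hx
    have hb := abs_deriv_pmul_le hρ.neg hδ0 hδ4 μ u x
    rw [← hD, ← hv] at hb
    have hw := wt_pos (P := P) δ (fun z => -ρ z) x
    have hwle : wt P δ (fun z => -ρ z) x ≤ Real.exp (-(δ * r)) := by
      rw [wt, Real.exp_le_exp]
      have := mul_le_mul_of_nonneg_left (hS x hx) hδ0
      linarith
    have hwsq : (wt P δ (fun z => -ρ z) x) ^ 2 ≤ Real.exp (-(2 * δ * r)) := by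
      calc (wt P δ (fun z => -ρ z) x) ^ 2 ≤ (Real.exp (-(δ * r))) ^ 2 := pow_le_pow_left₀ hw.le hwle 2
        _ = Real.exp (-(2 * δ * r)) := by rw [sq, ← Real.exp_add]; ring_nf
    set A := |(D *ᵥ u) x| with hA
    set B := |u x| with hB
    have hA0 : 0 ≤ A := abs_nonneg _
    have hB0 : 0 ≤ B := abs_nonneg _
    have h2δ : 2 * δ ≤ 1 / 2 := by linarith
    have hin : (3 / 2 * A + 2 * δ * B) ^ 2 ≤ 9 / 2 * (A ^ 2 + B ^ 2) := by
      have h3 : 2 * δ * B ≤ 1 / 2 * B := mul_le_mul_of_nonneg_right h2δ hB0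
      have h4 : 0 ≤ 2 * δ * B := by positivity
      nlinarith [sq_nonneg (A - B), sq_nonneg (3 / 2 * A + 2 * δ * B)]
    have habs : |(D *ᵥ v) x| ≤ wt P δ (fun z => -ρ z) x * (3 / 2 * A + 2 * δ * B) := hb
    have hsqv : ((D *ᵥ v) x) ^ 2 ≤ (wt P δ (fun z => -ρ z) x) ^ 2 * (3 / 2 * A + 2 * δ * B) ^ 2 := by
      rw [← sq_abs ((D *ᵥ v) x), ← mul_pow]
      exact pow_le_pow_left₀ (abs_nonneg _) habs 2
    have hAB : A ^ 2 + B ^ 2 = ((D *ᵥ u) x) ^ 2 + (u x) ^ 2 := by rw [hA, hB, sq_abs, sq_abs]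
    calc ((D *ᵥ v) x) ^ 2 ≤ (wt P δ (fun z => -ρ z) x) ^ 2 * (3 / 2 * A + 2 * δ * B) ^ 2 := hsqv
      _ ≤ Real.exp (-(2 * δ * r)) * (9 / 2 * (A ^ 2 + B ^ 2)) :=
          mul_le_mul hwsq hin (sq_nonneg _) (Real.exp_nonneg _)
      _ = 9 / 2 * Real.exp (-(2 * δ * r)) * (((D *ᵥ u) x) ^ 2 + (u x) ^ 2) := by rw [hAB]; ring
  have hsumD : ∑ x ∈ S, ((D *ᵥ u) x) ^ 2 ≤ dirE P k u := by
    refine le_trans (Finset.sum_le_univ_sum_of_nonneg fun x => sq_nonneg ((D *ᵥ u) x)) ?_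
    rw [hD]
    exact sum_sq_deriv_le_dirE k μ u
  have hsumU : ∑ x ∈ S, (u x) ^ 2 ≤ nsq P u := by
    unfold nsq
    exact Finset.sum_le_univ_sum_of_nonneg fun x => sq_nonneg (u x)
  have hE := Real.exp_nonneg (-(2 * δ * r))
  have hdn : 0 ≤ dirE P k u + nsq P u := add_nonneg (dirE_nonneg k u) (nsq_nonneg u)
  calc ∑ x ∈ S, ((D *ᵥ v) x) ^ 2
      ≤ ∑ x ∈ S, 9 / 2 * Real.exp (-(2 * δ * r)) * (((D *ᵥ u) x) ^ 2 + (u x) ^ 2) := Finset.sum_le_sum hpt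
    _ = 9 / 2 * Real.exp (-(2 * δ * r)) * (∑ x ∈ S, ((D *ᵥ u) x) ^ 2 + ∑ x ∈ S, (u x) ^ 2) := by
        rw [← Finset.mul_sum, Finset.sum_add_distrib]
    _ ≤ 9 / 2 * Real.exp (-(2 * δ * r)) * (dirE P k u + nsq P u) :=
        mul_le_mul_of_nonneg_left (add_le_add hsumD hsumU) (by positivity)
    _ ≤ 9 * Real.exp (-(2 * δ * r)) * (dirE P k u + nsq P u) := by nlinarith

end Extract

/-! ## §4 Corollary 2.3 (2.30) at `A = 0` on the torus — explicit constants, one volume -/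

section Pairings

variable {a msq δ : ℝ}

/-- `e^{−2δr}·K² = (e^{−δr}·K)²`. [folklore] -/
private theorem exp_mul_sq (δ r K : ℝ) : Real.exp (-(2 * δ * r)) * K ^ 2 = (Real.exp (-(δ * r)) * K) ^ 2 := by
  rw [mul_pow, sq (Real.exp _), ← Real.exp_add]; ring_nf

/-- the degenerate case: an identically vanishing source. [folklore] -/
private theorem eq_zero_of_not_nonempty {f' : Site P 0 → ℝ} (hT : ¬ (Finset.univ.filter fun x' => f' x' ≠ 0).Nonempty) :
    f' = 0 := by
  funext x'
  by_contra h
  exact hT ⟨x', Finset.mem_filter.mpr ⟨Finset.mem_univ _, h⟩⟩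

/-- **(2.30), FIRST PAIRING, `A = 0`, ON THE TORUS, EXPLICIT**: for `1 ≤ k ≤ m + K`, `a > 0`, `m² ≥ 0`, an admissible `δ` and all `f, f′`
whose supports are `≥ r` apart in `η`-units: `|f ⬝ᵥ G_k^{resc}f′| ≤ (4/γ′)e^{−δr}√(Σf²)√(Σf′²)`, `γ′ = min{1, a(1 − L⁻²)}`.
[cite: Balaban1983RegularityDecay, Cor. 2.3 (2.30) p.580] -/
theorem pairing_G (hk1 : 1 ≤ k) (hk : k ≤ P.m + P.K) (ha : 0 < a) (hm : 0 ≤ msq) (hδ0 : 0 ≤ δ) (hδ4 : 4 * δ ≤ 1)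
    (hδγ : (2 * P.d + 4 * a) * δ ^ 2 ≤ min 1 (a * (1 - ((P.L : ℝ) ^ 2)⁻¹)) / 4) (f f' : Site P 0 → ℝ) (r : ℝ)
    (hsep : ∀ x x', f x ≠ 0 → f' x' ≠ 0 → r ≤ distX P k x x') :
    |f ⬝ᵥ (Grs P a msq k *ᵥ f')|
      ≤ 4 / min 1 (a * (1 - ((P.L : ℝ) ^ 2)⁻¹)) * Real.exp (-(δ * r)) * Real.sqrt (nsq P f) * Real.sqrt (nsq P f') := by
  set γ' := min 1 (a * (1 - ((P.L : ℝ) ^ 2)⁻¹)) with hγ'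
  have hγ : 0 < γ' := gammaPrime_pos ha
  by_cases hT : (Finset.univ.filter fun x' => f' x' ≠ 0).Nonempty
  · obtain ⟨ρ, hρ, hρ0, -, hρr⟩ := exists_exponent k hT
    set v := Grs P a msq k *ᵥ f' with hv
    have hsolve := solve_bound hρ hk hk1 ha hm hδ0 hδ4 hδγ f'
    rw [← hγ', ← hv] at hsolve
    have hw1 : nsq P (pmul (wt P δ ρ) f') = nsq P f' :=
      nsq_pmul_eq_of_one fun x hx => by
        rw [wt, hρ0 x (Finset.mem_filter.mpr ⟨Finset.mem_univ _, hx⟩), mul_zero, Real.exp_zero]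
    rw [hw1] at hsolve
    have hS : ∀ x ∈ Finset.univ.filter (fun x => f x ≠ 0), r ≤ ρ x := fun x hx =>
      hρr x r fun x' hx' => hsep x x' (Finset.mem_filter.mp hx).2 (Finset.mem_filter.mp hx').2
    have hex := sum_sq_le_of_exponent hδ0 hS v
    have hB0 : 0 ≤ Real.exp (-(δ * r)) * (4 / γ' * Real.sqrt (nsq P f')) := by positivity
    have hbound : ∑ x ∈ Finset.univ.filter (fun x => f x ≠ 0), v x ^ 2
        ≤ (Real.exp (-(δ * r)) * (4 / γ' * Real.sqrt (nsq P f'))) ^ 2 := by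
      rw [← exp_mul_sq, mul_pow, Real.sq_sqrt (nsq_nonneg _)]
      refine hex.trans (mul_le_mul_of_nonneg_left ?_ (Real.exp_nonneg _))
      linarith [dirE_nonneg k (pmul (wt P δ ρ) v)]
    calc |f ⬝ᵥ v| ≤ Real.sqrt (nsq P f) * (Real.exp (-(δ * r)) * (4 / γ' * Real.sqrt (nsq P f'))) :=
          abs_dot_le_of_support f v hB0 hbound
      _ = 4 / γ' * Real.exp (-(δ * r)) * Real.sqrt (nsq P f) * Real.sqrt (nsq P f') := by ring
  · rw [eq_zero_of_not_nonempty hT, Matrix.mulVec_zero, dotProduct_zero, abs_zero]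
    positivity

/-- **(2.30), SECOND PAIRING `⟨f, ∂^η_μG_kf′⟩`, `A = 0`, ON THE TORUS, EXPLICIT**: same data, `|f ⬝ᵥ ∂^η_μG_k^{resc}f′| ≤
(12/γ′)e^{−δr}√(Σf²)√(Σf′²)`. [cite: Balaban1983RegularityDecay, Cor. 2.3 (2.30) p.580] -/
theorem pairing_DG (hk1 : 1 ≤ k) (hk : k ≤ P.m + P.K) (ha : 0 < a) (hm : 0 ≤ msq) (hδ0 : 0 ≤ δ) (hδ4 : 4 * δ ≤ 1)
    (hδγ : (2 * P.d + 4 * a) * δ ^ 2 ≤ min 1 (a * (1 - ((P.L : ℝ) ^ 2)⁻¹)) / 4) (μ : Fin P.d) (f f' : Site P 0 → ℝ)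
    (r : ℝ) (hsep : ∀ x x', f x ≠ 0 → f' x' ≠ 0 → r ≤ distX P k x x') :
    |f ⬝ᵥ ((deriv P 0 ((P.L : ℝ) ^ k)⁻¹ μ * Grs P a msq k) *ᵥ f')|
      ≤ 12 / min 1 (a * (1 - ((P.L : ℝ) ^ 2)⁻¹)) * Real.exp (-(δ * r)) * Real.sqrt (nsq P f) * Real.sqrt (nsq P f') := by
  set γ' := min 1 (a * (1 - ((P.L : ℝ) ^ 2)⁻¹)) with hγ'
  have hγ : 0 < γ' := gammaPrime_pos ha
  rw [← Matrix.mulVec_mulVec]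
  by_cases hT : (Finset.univ.filter fun x' => f' x' ≠ 0).Nonempty
  · obtain ⟨ρ, hρ, hρ0, -, hρr⟩ := exists_exponent k hT
    set v := Grs P a msq k *ᵥ f' with hv
    have hsolve := solve_bound hρ hk hk1 ha hm hδ0 hδ4 hδγ f'
    rw [← hγ', ← hv] at hsolve
    have hw1 : nsq P (pmul (wt P δ ρ) f') = nsq P f' :=
      nsq_pmul_eq_of_one fun x hx => by
        rw [wt, hρ0 x (Finset.mem_filter.mpr ⟨Finset.mem_univ _, hx⟩), mul_zero, Real.exp_zero]
    rw [hw1] at hsolve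
    have hS : ∀ x ∈ Finset.univ.filter (fun x => f x ≠ 0), r ≤ ρ x := fun x hx =>
      hρr x r fun x' hx' => hsep x x' (Finset.mem_filter.mp hx).2 (Finset.mem_filter.mp hx').2
    have hex := sum_sq_deriv_le_of_exponent hρ hδ0 hδ4 hS μ v
    have hB0 : 0 ≤ Real.exp (-(δ * r)) * (12 / γ' * Real.sqrt (nsq P f')) := by positivity
    have hbound : ∑ x ∈ Finset.univ.filter (fun x => f x ≠ 0), ((deriv P 0 ((P.L : ℝ) ^ k)⁻¹ μ *ᵥ v) x) ^ 2
        ≤ (Real.exp (-(δ * r)) * (12 / γ' * Real.sqrt (nsq P f'))) ^ 2 := by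
      rw [← exp_mul_sq, mul_pow, Real.sq_sqrt (nsq_nonneg _)]
      refine hex.trans ?_
      have hE := Real.exp_nonneg (-(2 * δ * r))
      have h9 := mul_le_mul_of_nonneg_left hsolve (show 0 ≤ 9 * Real.exp (-(2 * δ * r)) by positivity)
      refine h9.trans (le_of_eq ?_)
      ring
    calc |f ⬝ᵥ (deriv P 0 ((P.L : ℝ) ^ k)⁻¹ μ *ᵥ v)|
        ≤ Real.sqrt (nsq P f) * (Real.exp (-(δ * r)) * (12 / γ' * Real.sqrt (nsq P f'))) :=
          abs_dot_le_of_support f _ hB0 hbound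
      _ = 12 / γ' * Real.exp (-(δ * r)) * Real.sqrt (nsq P f) * Real.sqrt (nsq P f') := by ring
  · rw [eq_zero_of_not_nonempty hT, Matrix.mulVec_zero, Matrix.mulVec_zero, dotProduct_zero, abs_zero]
    positivity

/-- **(2.30), THIRD PAIRING `⟨f, G_k∂^{η*}_νf′⟩`, `A = 0`, ON THE TORUS, EXPLICIT** (`∂^{η*} = ∂^{η⊤}`): same data,
`|f ⬝ᵥ G_k^{resc}∂^{η⊤}_νf′| ≤ (8/γ′)e^{−δr}√(Σf²)√(Σf′²)`. [cite: Balaban1983RegularityDecay, Cor. 2.3 (2.30) p.580] -/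
theorem pairing_GDt (hk1 : 1 ≤ k) (hk : k ≤ P.m + P.K) (ha : 0 < a) (hm : 0 ≤ msq) (hδ0 : 0 ≤ δ) (hδ4 : 4 * δ ≤ 1)
    (hδγ : (2 * P.d + 4 * a) * δ ^ 2 ≤ min 1 (a * (1 - ((P.L : ℝ) ^ 2)⁻¹)) / 4) (ν : Fin P.d) (f f' : Site P 0 → ℝ)
    (r : ℝ) (hsep : ∀ x x', f x ≠ 0 → f' x' ≠ 0 → r ≤ distX P k x x') :
    |f ⬝ᵥ ((Grs P a msq k * (deriv P 0 ((P.L : ℝ) ^ k)⁻¹ ν)ᵀ) *ᵥ f')|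
      ≤ 8 / min 1 (a * (1 - ((P.L : ℝ) ^ 2)⁻¹)) * Real.exp (-(δ * r)) * Real.sqrt (nsq P f) * Real.sqrt (nsq P f') := by
  set γ' := min 1 (a * (1 - ((P.L : ℝ) ^ 2)⁻¹)) with hγ'
  have hγ : 0 < γ' := gammaPrime_pos ha
  rw [← Matrix.mulVec_mulVec]
  by_cases hT : (Finset.univ.filter fun x' => f' x' ≠ 0).Nonempty
  · obtain ⟨ρ, hρ, hρ0, -, hρr⟩ := exists_exponent k hT
    set v := Grs P a msq k *ᵥ ((deriv P 0 ((P.L : ℝ) ^ k)⁻¹ ν)ᵀ *ᵥ f') with hv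
    have hsolve := solveT_bound hρ hk hk1 ha hm hδ0 hδ4 hδγ ν f'
    rw [← hγ', ← hv] at hsolve
    have hw1 : nsq P (pmul (wt P δ ρ) f') = nsq P f' :=
      nsq_pmul_eq_of_one fun x hx => by
        rw [wt, hρ0 x (Finset.mem_filter.mpr ⟨Finset.mem_univ _, hx⟩), mul_zero, Real.exp_zero]
    rw [hw1] at hsolve
    have hS : ∀ x ∈ Finset.univ.filter (fun x => f x ≠ 0), r ≤ ρ x := fun x hx =>
      hρr x r fun x' hx' => hsep x x' (Finset.mem_filter.mp hx).2 (Finset.mem_filter.mp hx').2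
    have hex := sum_sq_le_of_exponent hδ0 hS v
    have hB0 : 0 ≤ Real.exp (-(δ * r)) * (8 / γ' * Real.sqrt (nsq P f')) := by positivity
    have hbound : ∑ x ∈ Finset.univ.filter (fun x => f x ≠ 0), v x ^ 2
        ≤ (Real.exp (-(δ * r)) * (8 / γ' * Real.sqrt (nsq P f'))) ^ 2 := by
      rw [← exp_mul_sq, mul_pow, Real.sq_sqrt (nsq_nonneg _)]
      refine hex.trans (mul_le_mul_of_nonneg_left ?_ (Real.exp_nonneg _))
      linarith [dirE_nonneg k (pmul (wt P δ ρ) v)]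
    calc |f ⬝ᵥ v| ≤ Real.sqrt (nsq P f) * (Real.exp (-(δ * r)) * (8 / γ' * Real.sqrt (nsq P f'))) :=
          abs_dot_le_of_support f v hB0 hbound
      _ = 8 / γ' * Real.exp (-(δ * r)) * Real.sqrt (nsq P f) * Real.sqrt (nsq P f') := by ring
  · rw [eq_zero_of_not_nonempty hT, Matrix.mulVec_zero, Matrix.mulVec_zero, dotProduct_zero, abs_zero]
    positivity

/-- **(2.30), FOURTH PAIRING `⟨f, ∂^η_μG_k∂^{η*}_νf′⟩`, `A = 0`, ON THE TORUS, EXPLICIT** — the `L²`-bounded, `ℓ^∞`-unbounded second-order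
quantity: same data, `|f ⬝ᵥ ∂^η_μG_k^{resc}∂^{η⊤}_νf′| ≤ (24/γ′)e^{−δr}√(Σf²)√(Σf′²)`. [cite: Balaban1983RegularityDecay, Cor. 2.3 (2.30) p.580] -/
theorem pairing_DGDt (hk1 : 1 ≤ k) (hk : k ≤ P.m + P.K) (ha : 0 < a) (hm : 0 ≤ msq) (hδ0 : 0 ≤ δ) (hδ4 : 4 * δ ≤ 1)
    (hδγ : (2 * P.d + 4 * a) * δ ^ 2 ≤ min 1 (a * (1 - ((P.L : ℝ) ^ 2)⁻¹)) / 4) (μ ν : Fin P.d)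
    (f f' : Site P 0 → ℝ) (r : ℝ) (hsep : ∀ x x', f x ≠ 0 → f' x' ≠ 0 → r ≤ distX P k x x') :
    |f ⬝ᵥ ((deriv P 0 ((P.L : ℝ) ^ k)⁻¹ μ * Grs P a msq k * (deriv P 0 ((P.L : ℝ) ^ k)⁻¹ ν)ᵀ) *ᵥ f')|
      ≤ 24 / min 1 (a * (1 - ((P.L : ℝ) ^ 2)⁻¹)) * Real.exp (-(δ * r)) * Real.sqrt (nsq P f) * Real.sqrt (nsq P f') := by
  set γ' := min 1 (a * (1 - ((P.L : ℝ) ^ 2)⁻¹)) with hγ'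
  have hγ : 0 < γ' := gammaPrime_pos ha
  rw [← Matrix.mulVec_mulVec, ← Matrix.mulVec_mulVec]
  by_cases hT : (Finset.univ.filter fun x' => f' x' ≠ 0).Nonempty
  · obtain ⟨ρ, hρ, hρ0, -, hρr⟩ := exists_exponent k hT
    set v := Grs P a msq k *ᵥ ((deriv P 0 ((P.L : ℝ) ^ k)⁻¹ ν)ᵀ *ᵥ f') with hv
    have hsolve := solveT_bound hρ hk hk1 ha hm hδ0 hδ4 hδγ ν f'
    rw [← hγ', ← hv] at hsolve
    have hw1 : nsq P (pmul (wt P δ ρ) f') = nsq P f' :=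
      nsq_pmul_eq_of_one fun x hx => by
        rw [wt, hρ0 x (Finset.mem_filter.mpr ⟨Finset.mem_univ _, hx⟩), mul_zero, Real.exp_zero]
    rw [hw1] at hsolve
    have hS : ∀ x ∈ Finset.univ.filter (fun x => f x ≠ 0), r ≤ ρ x := fun x hx =>
      hρr x r fun x' hx' => hsep x x' (Finset.mem_filter.mp hx).2 (Finset.mem_filter.mp hx').2
    have hex := sum_sq_deriv_le_of_exponent hρ hδ0 hδ4 hS μ v
    have hB0 : 0 ≤ Real.exp (-(δ * r)) * (24 / γ' * Real.sqrt (nsq P f')) := by positivity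
    have hbound : ∑ x ∈ Finset.univ.filter (fun x => f x ≠ 0), ((deriv P 0 ((P.L : ℝ) ^ k)⁻¹ μ *ᵥ v) x) ^ 2
        ≤ (Real.exp (-(δ * r)) * (24 / γ' * Real.sqrt (nsq P f'))) ^ 2 := by
      rw [← exp_mul_sq, mul_pow, Real.sq_sqrt (nsq_nonneg _)]
      refine hex.trans ?_
      have hE := Real.exp_nonneg (-(2 * δ * r))
      have h9 := mul_le_mul_of_nonneg_left hsolve (show 0 ≤ 9 * Real.exp (-(2 * δ * r)) by positivity)
      refine h9.trans (le_of_eq ?_)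
      ring
    calc |f ⬝ᵥ (deriv P 0 ((P.L : ℝ) ^ k)⁻¹ μ *ᵥ v)|
        ≤ Real.sqrt (nsq P f) * (Real.exp (-(δ * r)) * (24 / γ' * Real.sqrt (nsq P f'))) :=
          abs_dot_le_of_support f _ hB0 hbound
      _ = 24 / γ' * Real.exp (-(δ * r)) * Real.sqrt (nsq P f) * Real.sqrt (nsq P f') := by ring
  · rw [eq_zero_of_not_nonempty hT, Matrix.mulVec_zero, Matrix.mulVec_zero, Matrix.mulVec_zero, dotProduct_zero, abs_zero]
    positivity

end Pairings

/-! ## §5 Corollary 2.3 (2.30) at `A = 0` on the torus — the printed quantifier shape, uniform in the volume and the level -/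

/-- **COROLLARY 2.3 (2.30) AT `A = 0` ON THE TORUS — ALL FOUR PAIRINGS, HYPOTHESIS-FREE, UNIFORM.**  For `L > 1`, `a > 0` and any `d` there are
`δ₀, c₀ > 0` (`δ₀ = min{¼, γ′/(8d + 16a + 4)}`, `c₀ = 24/γ′`, `γ′ = min{1, a(1 − L⁻²)}`) such that for EVERY volume `(m, K)` of Bałaban's torus
family with `P.d = d`, `P.L = L`, every mass `m² ≥ 0`, every level `1 ≤ k ≤ m + K` (`η = L^{−k}`), all directions `μ, ν`, all `f, f′ : T_η → ℝ`
and every `r` with `r ≤ |x − x′|_η` whenever `f(x) ≠ 0 ≠ f′(x′)` (so `r = dist(supp f, supp f′)` in `η`-units):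
`|f·G_kf′|, |f·∂^η_μG_kf′|, |f·G_k∂^{η⊤}_νf′|, |f·∂^η_μG_k∂^{η⊤}_νf′| ≤ c₀e^{−δ₀r}√(Σf²)√(Σf′²)` (`G_k = G_k(T_η, 0)` rescaled, [B1] (2.22); the
common weight `η^d` of `⟨·,·⟩` and `‖·‖₂²` cancels).  *"now there are no restrictions on supports of f, f′"* — none here either; no mass cap,
no smallness condition (there is no field). [cite: Balaban1983RegularityDecay, Cor. 2.3 (2.30) pp.580–581] -/
theorem cor23_zero_torus (d L : ℕ) (hL : 1 < L) {a : ℝ} (ha : 0 < a) :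
    ∃ δ₀ c₀ : ℝ, 0 < δ₀ ∧ 0 < c₀ ∧ ∀ (P : Params), P.d = d → P.L = L → ∀ (msq : ℝ), 0 ≤ msq →
      ∀ (k : ℕ), 1 ≤ k → k ≤ P.m + P.K → ∀ (μ ν : Fin P.d) (f f' : Site P 0 → ℝ) (r : ℝ),
        (∀ x x', f x ≠ 0 → f' x' ≠ 0 → r ≤ distX P k x x') →
          |f ⬝ᵥ (Grs P a msq k *ᵥ f')|
              ≤ c₀ * Real.exp (-(δ₀ * r)) * Real.sqrt (nsq P f) * Real.sqrt (nsq P f') ∧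
          |f ⬝ᵥ ((deriv P 0 ((P.L : ℝ) ^ k)⁻¹ μ * Grs P a msq k) *ᵥ f')|
              ≤ c₀ * Real.exp (-(δ₀ * r)) * Real.sqrt (nsq P f) * Real.sqrt (nsq P f') ∧
          |f ⬝ᵥ ((Grs P a msq k * (deriv P 0 ((P.L : ℝ) ^ k)⁻¹ ν)ᵀ) *ᵥ f')|
              ≤ c₀ * Real.exp (-(δ₀ * r)) * Real.sqrt (nsq P f) * Real.sqrt (nsq P f') ∧
          |f ⬝ᵥ ((deriv P 0 ((P.L : ℝ) ^ k)⁻¹ μ * Grs P a msq k * (deriv P 0 ((P.L : ℝ) ^ k)⁻¹ ν)ᵀ) *ᵥ f')|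
              ≤ c₀ * Real.exp (-(δ₀ * r)) * Real.sqrt (nsq P f) * Real.sqrt (nsq P f') := by
  set γ' := min 1 (a * (1 - ((L : ℝ) ^ 2)⁻¹)) with hγ'
  have hL1 : (1 : ℝ) < L := by exact_mod_cast hL
  have hγ : 0 < γ' := by
    have hL2 : (1 : ℝ) < (L : ℝ) ^ 2 := by nlinarith
    have hinv : ((L : ℝ) ^ 2)⁻¹ < 1 := inv_lt_one_of_one_lt₀ hL2
    exact lt_min one_pos (mul_pos ha (by linarith))
  have hden : (0 : ℝ) < 8 * d + 16 * a + 4 := by positivity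
  set δ₀ := min (1 / 4 : ℝ) (γ' / (8 * d + 16 * a + 4)) with hδ₀
  have hδ₀pos : 0 < δ₀ := lt_min (by norm_num) (div_pos hγ hden)
  have hδ₀0 : 0 ≤ δ₀ := hδ₀pos.le
  have hδ₀4 : 4 * δ₀ ≤ 1 := by
    have := min_le_left (1 / 4 : ℝ) (γ' / (8 * d + 16 * a + 4)); linarith
  have hδ₀γ : (2 * (d : ℝ) + 4 * a) * δ₀ ^ 2 ≤ γ' / 4 := by
    have h1 : δ₀ ≤ 1 / 4 := min_le_left _ _
    have h2 : δ₀ ≤ γ' / (8 * d + 16 * a + 4) := min_le_right _ _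
    have h3 : δ₀ ^ 2 ≤ 1 / 4 * (γ' / (8 * d + 16 * a + 4)) := by
      rw [sq]; exact mul_le_mul h1 h2 hδ₀0 (by norm_num)
    have hd0 : (0 : ℝ) ≤ 2 * d + 4 * a := by positivity
    calc (2 * (d : ℝ) + 4 * a) * δ₀ ^ 2 ≤ (2 * (d : ℝ) + 4 * a) * (1 / 4 * (γ' / (8 * d + 16 * a + 4))) :=
          mul_le_mul_of_nonneg_left h3 hd0
      _ = γ' / 4 * ((2 * d + 4 * a) / (8 * d + 16 * a + 4)) := by ring
      _ ≤ γ' / 4 * 1 := by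
          refine mul_le_mul_of_nonneg_left ?_ (by positivity)
          rw [div_le_one hden]; linarith
      _ = γ' / 4 := mul_one _
  refine ⟨δ₀, 24 / γ', hδ₀pos, div_pos (by norm_num) hγ, ?_⟩
  intro P hPd hPL msq hm k hk1 hk μ ν f f' r hsep
  subst hPd hPL
  have hmono : ∀ {c : ℝ}, c ≤ 24 → ∀ {X : ℝ},
      X ≤ c / γ' * Real.exp (-(δ₀ * r)) * Real.sqrt (nsq P f) * Real.sqrt (nsq P f') →
      X ≤ 24 / γ' * Real.exp (-(δ₀ * r)) * Real.sqrt (nsq P f) * Real.sqrt (nsq P f') := by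
    intro c hc X hX
    refine hX.trans ?_
    have hrest : 0 ≤ Real.exp (-(δ₀ * r)) * Real.sqrt (nsq P f) * Real.sqrt (nsq P f') := by positivity
    have hcd : c / γ' ≤ 24 / γ' := div_le_div_of_nonneg_right hc hγ.le
    calc c / γ' * Real.exp (-(δ₀ * r)) * Real.sqrt (nsq P f) * Real.sqrt (nsq P f')
        = c / γ' * (Real.exp (-(δ₀ * r)) * Real.sqrt (nsq P f) * Real.sqrt (nsq P f')) := by ring
      _ ≤ 24 / γ' * (Real.exp (-(δ₀ * r)) * Real.sqrt (nsq P f) * Real.sqrt (nsq P f')) :=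
          mul_le_mul_of_nonneg_right hcd hrest
      _ = 24 / γ' * Real.exp (-(δ₀ * r)) * Real.sqrt (nsq P f) * Real.sqrt (nsq P f') := by ring
  exact ⟨hmono (by norm_num) (pairing_G hk1 hk ha hm hδ₀0 hδ₀4 hδ₀γ f f' r hsep),
    hmono (by norm_num) (pairing_DG hk1 hk ha hm hδ₀0 hδ₀4 hδ₀γ μ f f' r hsep),
    hmono (by norm_num) (pairing_GDt hk1 hk ha hm hδ₀0 hδ₀4 hδ₀γ ν f f' r hsep),
    hmono le_rfl (pairing_DGDt hk1 hk ha hm hδ₀0 hδ₀4 hδ₀γ μ ν f f' r hsep)⟩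

end B4Cor23ZeroTorus

end

end Literature.MathematicalPhysics.QuantumFieldTheory.Balaban1983to89
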